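import Summits.PneNP.PneNP.Theorems.OracleRefusal.Negative.StaInvChainShape

/-!
# `OracleRefusal` (stmt-PneNP-1864) — negative side, II: Semantic inversion, part 6 (§B.8, first half): CHAIN DATA and the descriptions of valuations of chain runs (`ChainData`,
`HeadsDesc`, `ChainTail`, kernel condition `KernelOK`) with their transport along `(w)`, `(∀I)`, `(m)` (`chainInv_mpx`).
-/

namespace Summit.PneNP.PneNP.Theorems.OracleRefusal.Negative

open Literature.Computability.ImplicitComplexity
open Literature.Computability.ImplicitComplexity.URel
open Literature.Computability.ImplicitComplexity.STA (Deriv Ctx Term LinTy SoftTy encWord encBit tyS tyB tyF mpxRen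
  liftRen)

/-! ## §B.8 Run descriptions of chains -/

/-- The sequence `a, f 0, f 1, …`. [folklore] -/
def consF (a : Point) (f : ℕ → Point) : ℕ → Point
  | 0 => a
  | j + 1 => f j

/-- Head of `consF`. [folklore] -/
@[simp] theorem consF_zero (a : Point) (f : ℕ → Point) : consF a f 0 = a := rfl
/-- Tail of `consF`. [folklore] -/
@[simp] theorem consF_succ (a : Point) (f : ℕ → Point) (j : ℕ) : consF a f (j + 1) = f j := rfl

/-- The occurrence point `P‾ ⅋ (R‾ ⅋ q)` of a head run with letter label `P`, rest label `R`, result `q`.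
[cite: LaurentTortoraDeFalco2006, Def. 12] -/
def occPt (P R q : Point) : Point := P.dual.par (R.dual.par q)

/-- The occurrence points of the `J` evaluated positions. [folklore] -/
def Lset (J : ℕ) (qs P R : ℕ → Point) : Set Point := {a | ∃ j < J, a = occPt (P j) (R j) (qs j)}

/-- The KERNEL condition on a head variable: its context type is an anti-instance of the step type
`tyF = B ⊸ α ⊸ α`. [cite: GaboardiMarionRonchidellarocca2008, §3.2] -/
def KernelOK (K : LinTy) : Prop := ∃ θ : ℕ → LinTy, K.substp θ = tyF

/-- The anti-instances of the step type: a type variable, or `B₁ ⊸ A₁` with `B₁` BoolLike and `A₁` a type variable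
or a linear arrow. [cite: GaboardiMarionRonchidellarocca2008, §3.2] -/
theorem KernelOK.cases {K : LinTy} (h : KernelOK K) :
    (∃ n, K = .tvar n) ∨ ∃ B₁ A₁, K = .limp 0 B₁ A₁ ∧ BoolLike B₁ ∧
      ((∃ n, A₁ = .tvar n) ∨ ∃ A₂ A₃, A₁ = .limp 0 A₂ A₃) := by
  obtain ⟨θ, hθ⟩ := h
  cases K with
  | tvar n => exact Or.inl ⟨n, rfl⟩
  | all _ => simp [STA.LinTy.substp, STA.tyF] at hθ
  | limp k B₁ A₁ =>
    simp only [STA.LinTy.substp, STA.tyF, LinTy.limp.injEq] at hθ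
    obtain ⟨rfl, hB, hA⟩ := hθ
    refine Or.inr ⟨B₁, A₁, rfl, ?_, ?_⟩
    · exact BoolLike.of_substp (τ := θ) (by rw [hB]; exact boolLike_tyB)
    · cases A₁ with
      | tvar n => exact Or.inl ⟨n, rfl⟩
      | all _ => simp [STA.LinTy.substp] at hA
      | limp k' A₂ A₃ =>
        simp only [STA.LinTy.substp, LinTy.limp.injEq] at hA
        obtain ⟨rfl, -, -⟩ := hA
        exact Or.inr ⟨A₂, A₃, rfl⟩

/-- The kernel condition survives the shift of `(∀I)`. [folklore] -/
theorem KernelOK.rename_succ {K : LinTy} (h : KernelOK K) : KernelOK (K.rename Nat.succ) := by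
  obtain ⟨θ, hθ⟩ := h
  refine ⟨fun n => θ (n - 1), ?_⟩
  rw [STA.LinTy.substp_rename]
  exact hθ

/-- The step type itself satisfies the kernel condition. [cite: GaboardiMarionRonchidellarocca2008, §3.2] -/
theorem kernelOK_tyF : KernelOK tyF := ⟨LinTy.tvar, STA.LinTy.substp_tvar _⟩

/-- CHAIN DATA of a run of a chain with letters `bs`: `J` evaluated positions (`1 ≤ J ≤ |bs|` if `bs ≠ []`), chain
values `qs`, letter labels `P j` (at most one copy of a point of `⟦bs_j⟧`), rest labels `R j = ![qs (j+1)]` before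
the last evaluated position. [cite: LaurentTortoraDeFalco2006, Def. 12] -/
def ChainData (bs : List Bool) (J : ℕ) (qs P R : ℕ → Point) : Prop :=
  J ≤ bs.length ∧ (bs ≠ [] → 1 ≤ J) ∧ (∀ j < J, LetterLabel (bs.getD j false) (P j)) ∧
    (∀ j, j + 1 < J → R j = bang1 (qs (j + 1)))

/-- HEADS DESCRIPTION of a valuation: every head slot carries a box tree over the occurrence points, every other
slot outside `Z` is junk, and every occurrence point is a real leaf of some head slot.
[cite: LaurentTortoraDeFalco2006, Def. 12] -/
def HeadsDesc (Γ : Ctx) (ρ : Val) (hs : List ℕ) (Z : Set ℕ) (J : ℕ) (qs P R : ℕ → Point) : Prop :=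
  (∀ s ∈ hs, SlotIn (fun k => argClique k (Lset J qs P R)) Γ ρ s) ∧
  (∀ s, s ∉ hs → s ∉ Z → SlotIn Junk Γ ρ s) ∧
  (∀ j < J, ∃ s ∈ hs, ∃ σ V, Γ s = some σ ∧ ρ s = some V ∧ occPt (P j) (R j) (qs j) ∈ leafSet σ.bangs V)

/-- TAIL DESCRIPTION at the tail variable `z` of a chain of length `n`: either everything is evaluated and `z` is
used once at the last chain value (slot wrapped around `![qs n]`), or the rest after the last evaluated position is
discarded (`R (J-1) = ![]`) and `z` is junk. [cite: LaurentTortoraDeFalco2006, Def. 12] -/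
def ChainTail (Γ : Ctx) (ρ : Val) (z n J : ℕ) (qs R : ℕ → Point) : Prop :=
  (J = n ∧ (∀ j, j + 1 = n → R j = bang1 (qs n)) ∧ SlotIn (fun k => Wrap k (bang1 (qs n))) Γ ρ z) ∨
  (1 ≤ J ∧ R (J - 1) = bang0 ∧ SlotIn Junk Γ ρ z)

/-- The occurrence points of a one-step-longer chain. [folklore] -/
theorem Lset_cons (q Pb V : Point) (J : ℕ) (qs P R : ℕ → Point) :
    Lset (J + 1) (consF q qs) (consF Pb P) (consF V R) = insert (occPt Pb V q) (Lset J qs P R) := by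
  ext a
  constructor
  · rintro ⟨j, hj, rfl⟩
    rcases j with _ | j
    · exact Or.inl rfl
    · exact Or.inr ⟨j, by omega, rfl⟩
  · rintro (rfl | ⟨j, hj, rfl⟩)
    · exact ⟨0, by omega, rfl⟩
    · exact ⟨j + 1, by omega, rfl⟩

/-- Chain data of a one-step-longer run, rest evaluated. [folklore] -/
theorem ChainData.cons {bs : List Bool} {J : ℕ} {qs P R : ℕ → Point} (h : ChainData bs J qs P R) {b : Bool}
    {Pb q : Point} (hPb : LetterLabel b Pb) :
    ChainData (b :: bs) (J + 1) (consF q qs) (consF Pb P) (consF (bang1 (qs 0)) R) := by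
  obtain ⟨hJ, -, hP, hR⟩ := h
  refine ⟨by simpa using hJ, fun _ => by omega, fun j hj => ?_, fun j hj => ?_⟩
  · rcases j with _ | j
    · simpa using hPb
    · simpa using hP j (by omega)
  · rcases j with _ | j
    · rfl
    · exact hR j (by omega)

/-- Chain data of a run whose first rest is discarded. [folklore] -/
theorem ChainData.one {bs : List Bool} {qs P R : ℕ → Point} {b : Bool} {Pb q : Point} (hPb : LetterLabel b Pb) :
    ChainData (b :: bs) 1 (consF q qs) (consF Pb P) (consF bang0 R) :=
  ⟨by simp, fun _ => le_rfl, fun j hj => by obtain rfl : j = 0 := (by omega); simpa using hPb, fun j hj => by omega⟩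

namespace HeadsDesc

variable {Γ : Ctx} {ρ : Val} {hs : List ℕ} {Z : Set ℕ} {J : ℕ} {qs P R : ℕ → Point}

/-- `(w)` below a chain. [folklore] -/
theorem weak (h : HeadsDesc Γ ρ hs Z J qs P R) {j : ℕ} (hj : Γ j = none) (A : LinTy) :
    HeadsDesc (Function.update Γ j (some ⟨0, A⟩)) (Function.update ρ j (some bang0)) hs Z J qs P R := by
  obtain ⟨hH, hN, hC⟩ := h
  refine ⟨fun s hs' => ?_, fun s hs₁ hs₂ => ?_, fun j' hj' => ?_⟩
  · by_cases hsj : s = j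
    · subst hsj; exact SlotIn.update_self_of_bang0 (mem_liftClique.2 (Or.inl rfl)) s A
    · exact (hH s hs').update_ne hsj _ _
  · by_cases hsj : s = j
    · subst hsj; exact SlotIn.update_self_junk s A
    · exact (hN s hs₁ hs₂).update_ne hsj _ _
  · obtain ⟨s, hs', σ, V, hΓs, hρs, hm⟩ := hC j' hj'
    have hsj : s ≠ j := fun e => by rw [e, hj] at hΓs; cases hΓs
    exact ⟨s, hs', σ, V, by rw [Function.update_of_ne hsj, hΓs], by rw [Function.update_of_ne hsj, hρs], hm⟩

/-- `(∀I)` below a chain. [folklore] -/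
theorem of_shift (h : HeadsDesc Γ.shift ρ hs Z J qs P R) : HeadsDesc Γ ρ hs Z J qs P R := by
  obtain ⟨hH, hN, hC⟩ := h
  refine ⟨fun s hs' => (hH s hs').of_shift, fun s h1 h2 => (hN s h1 h2).of_shift, fun j' hj' => ?_⟩
  obtain ⟨s, hs', σ, V, hΓs, hρs, hm⟩ := hC j' hj'
  simp only [Ctx.shift, Option.map_eq_some_iff] at hΓs
  obtain ⟨σ', hσ', rfl⟩ := hΓs
  exact ⟨s, hs', σ', V, hσ', hρs, hm⟩

/-- Monotonicity of the heads description in the set of occurrence points (used with `Lset` inclusions). [folklore] -/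
theorem slot_mono {L L' : Set Point} (hL : L ⊆ L') {s : ℕ} (h : SlotIn (fun k => argClique k L) Γ ρ s) :
    SlotIn (fun k => argClique k L') Γ ρ s :=
  h.mono fun k => argClique_mono hL k

end HeadsDesc

/-- `(w)` below a chain, tail part. [folklore] -/
theorem ChainTail.weak {Γ : Ctx} {ρ : Val} {z n J : ℕ} {qs R : ℕ → Point} (h : ChainTail Γ ρ z n J qs R) {j : ℕ}
    (hzj : z ≠ j) (τ : Option SoftTy) (v : Option Point) :
    ChainTail (Function.update Γ j τ) (Function.update ρ j v) z n J qs R := by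
  rcases h with ⟨h1, h2, h3⟩ | ⟨h1, h2, h3⟩
  · exact Or.inl ⟨h1, h2, h3.update_ne hzj _ _⟩
  · exact Or.inr ⟨h1, h2, h3.update_ne hzj _ _⟩

/-- `(∀I)` below a chain, tail part. [folklore] -/
theorem ChainTail.of_shift {Γ : Ctx} {ρ : Val} {z n J : ℕ} {qs R : ℕ → Point} (h : ChainTail Γ.shift ρ z n J qs R) :
    ChainTail Γ ρ z n J qs R := by
  rcases h with ⟨h1, h2, h3⟩ | ⟨h1, h2, h3⟩
  · exact Or.inl ⟨h1, h2, h3.of_shift⟩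
  · exact Or.inr ⟨h1, h2, h3.of_shift⟩

/-- **`(m)` below a chain.** Contracting slots `S` into the fresh slot `j`: heads go to heads (a box over trees over
`L` is a tree over `L`; co-contracted non-heads are junk), junk to junk, the tail slot to the tail slot (wrapped one
level up with junk, or junk), and every real leaf stays a real leaf of a head slot.
[cite: LaurentTortoraDeFalco2006, Def. 12] -/
theorem chainInv_mpx {Γ : Ctx} {ρ : Val} {hs₀ : List ℕ} {z₀ J n : ℕ} {qs P R : ℕ → Point}
    (hH : HeadsDesc Γ ρ hs₀ {z₀} J qs P R) (hT : ChainTail Γ ρ z₀ n J qs R)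
    {S : Finset ℕ} {j : ℕ} {τ₀ : SoftTy} (hS : ∀ s ∈ S, Γ s = some τ₀) (hj : Γ j = none)
    (hzh : mpxRen S j z₀ ∉ hs₀.map (mpxRen S j)) (hzp : ∃ τ, Γ z₀ = some τ) (hhp : ∀ c ∈ hs₀, ∃ τ, Γ c = some τ) :
    HeadsDesc (Γ.mpx S j τ₀) (mpxVal S j ρ) (hs₀.map (mpxRen S j)) {mpxRen S j z₀} J qs P R ∧
      ChainTail (Γ.mpx S j τ₀) (mpxVal S j ρ) (mpxRen S j z₀) n J qs R := by
  obtain ⟨hHd, hN, hC⟩ := hH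
  have hjS : j ∉ S := fun hj' => by simpa [hj] using hS j hj'
  have hf_mem : ∀ {i}, i ∈ S → mpxRen S j i = j := fun hi => by simp [mpxRen, hi]
  have hf_nmem : ∀ {i}, i ∉ S → mpxRen S j i = i := fun hi => by simp [mpxRen, hi]
  have hjz : z₀ ≠ j := fun e => by obtain ⟨τ, hτ⟩ := hzp; rw [e, hj] at hτ; cases hτ
  have hjh : j ∉ hs₀ := fun hm => by obtain ⟨τ, hτ⟩ := hhp j hm; rw [hj] at hτ; cases hτ
  -- if the tail slot is contracted, no head is
  have hzS : z₀ ∈ S → ∀ c ∈ hs₀, c ∉ S := fun hz c hc hcS =>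
    hzh (List.mem_map.2 ⟨c, hc, by rw [hf_mem hcS, hf_mem hz]⟩)
  -- junk co-members
  have hjunk : ∀ i ∈ S, i ∉ hs₀ → i ≠ z₀ → SlotIn Junk Γ ρ i := fun i _ h1 h2 => hN i h1 h2
  refine ⟨⟨fun s hs' => ?_, fun s hs₁ hs₂ => ?_, fun j' hj' => ?_⟩, ?_⟩
  · -- heads
    obtain ⟨c₀, hc₀, rfl⟩ := List.mem_map.1 hs'
    by_cases hcS : c₀ ∈ S
    · rw [hf_mem hcS]
      refine SlotIn.mpx_self (boxable_argClique _) hS hj fun i hi => ?_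
      by_cases hih : i ∈ hs₀
      · exact hHd i hih
      · have hiz : i ≠ z₀ := fun e => hzS (e ▸ hi) c₀ hc₀ hcS
        exact (hjunk i hi hih hiz).mono fun k => junk_subset_argClique _ k
    · rw [hf_nmem hcS]
      have hcj : c₀ ≠ j := fun e => hjh (e ▸ hc₀)
      exact (hHd c₀ hc₀).mpx_of_not_mem hcS hcj
  · -- non-heads
    by_cases hsS : s ∈ S
    · exact SlotIn.mpx_of_mem hsS
    · by_cases hsj : s = j
      · subst hsj
        refine SlotIn.mpx_self boxable_junk hS hj fun i hi => hjunk i hi (fun hih => ?_) (fun hiz => ?_)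
        · exact hs₁ (List.mem_map.2 ⟨i, hih, hf_mem hi⟩)
        · exact hs₂ (by rw [Set.mem_singleton_iff, ← hiz, hf_mem hi])
      · have hsh : s ∉ hs₀ := fun h => hs₁ (List.mem_map.2 ⟨s, h, hf_nmem hsS⟩)
        have hsz : s ≠ z₀ := by
          intro e
          subst e
          by_cases hzS' : s ∈ S
          · exact hsS hzS'
          · exact hs₂ (by rw [Set.mem_singleton_iff, hf_nmem hzS'])
        exact (hN s hsh hsz).mpx_of_not_mem hsS hsj
  · -- coverage
    obtain ⟨s₀, hs₀m, σ, V, hΓs, hρs, hm⟩ := hC j' hj'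
    refine ⟨mpxRen S j s₀, List.mem_map.2 ⟨s₀, hs₀m, rfl⟩, ?_⟩
    by_cases hsS : s₀ ∈ S
    · rw [hf_mem hsS]
      have hσ : σ = τ₀ := by have := hS s₀ hsS; rw [hΓs] at this; cases this; rfl
      subst hσ
      refine ⟨σ.bang, Point.ofCourse (S.val.map ρ.label), by simp [Ctx.mpx, hjS], by simp [mpxVal, hjS], ?_⟩
      show occPt (P j') (R j') (qs j') ∈ leafSet (σ.bangs + 1) _
      rw [mem_leafSet_ofCourse]
      exact ⟨V, Multiset.mem_map.2 ⟨s₀, Finset.mem_def.1 hsS, by simp [Val.label, hρs]⟩, hm⟩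
    · rw [hf_nmem hsS]
      have hsj : s₀ ≠ j := fun e => by rw [e, hj] at hΓs; cases hΓs
      exact ⟨σ, V, by simp [Ctx.mpx, hsS, hsj, hΓs], by simp [mpxVal, hsS, hsj, hρs], hm⟩
  · -- tail
    rcases hT with ⟨h1, h2, h3⟩ | ⟨h1, h2, h3⟩
    · refine Or.inl ⟨h1, h2, ?_⟩
      by_cases hzS' : z₀ ∈ S
      · rw [hf_mem hzS']
        intro σ hσ'
        simp only [Ctx.mpx, hjS, if_false, if_true, Option.some.injEq] at hσ'
        subst hσ'
        refine ⟨Point.ofCourse (S.val.map ρ.label), by simp [mpxVal, hjS], ?_⟩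
        show Point.ofCourse (S.val.map ρ.label) ∈ Wrap (τ₀.bangs + 1) (bang1 (qs n))
        obtain ⟨V, hV, hVm⟩ := h3 _ (hS z₀ hzS')
        refine ⟨V, hVm, (S.erase z₀).val.map ρ.label, fun y hy => ?_, ?_⟩
        · obtain ⟨i, hi, rfl⟩ := Multiset.mem_map.1 hy
          rw [Finset.mem_val, Finset.mem_erase] at hi
          obtain ⟨Jk, hJ', hJm⟩ := hjunk i hi.2 (fun hih => hzS hzS' i hih hi.2) hi.1 _ (hS i hi.2)
          simpa [Val.label, hJ'] using hJm
        · rw [← Multiset.cons_erase (Finset.mem_def.1 hzS'), Multiset.map_cons, Finset.erase_val]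
          simp [Val.label, hV]
      · rw [hf_nmem hzS']
        exact h3.mpx_of_not_mem hzS' hjz
    · refine Or.inr ⟨h1, h2, ?_⟩
      by_cases hzS' : z₀ ∈ S
      · rw [hf_mem hzS']
        refine SlotIn.mpx_self boxable_junk hS hj fun i hi => ?_
        by_cases hiz : i = z₀
        · subst hiz; exact h3
        · exact hjunk i hi (fun hih => hzS hzS' i hih hi) hiz
      · rw [hf_nmem hzS']
        exact h3.mpx_of_not_mem hzS' hjz

end Summit.PneNP.PneNP.Theorems.OracleRefusal.Negative
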